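import Mathlib
import HarnessLib
import Summits.Ventures.LatticeQCDFlow.Exactness.SphereAmbientDriftExponential
import Summits.Ventures.LatticeQCDFlow.Exactness.SphereGeodesicRotationIsometry
import Summits.Ventures.LatticeQCDFlow.Exactness.SphereHMCExact

/-!
# The sphere leapfrog in the body frame: frames evolve by right composition with geodesic rotations, momenta by body-frame kicks — a kicked product

HONEST FRAMING: exact (Metropolis-corrected) sampling algorithms for lattice gauge theory;
figures of merit are autocorrelation/cost numbers at stated couplings and volumes; no
continuum-physics claim.

Venture `LatticeQCDFlow` (cell pub-lqcd), topic `Exactness`, FANOUT row 9 (eng-latcore, the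
engine `latflow.core.cpn_2d.HMCCPN`: kick – exact geodesic drift – kick on every site sphere).  NEW WORK
of the cell over the tree (`SphereGeodesicExponential.lean`, `SphereAmbientDriftExponential.lean`,
`SphereGeodesicRotationIsometry.lean`: generator `geodGen`, `ambientDrift_eq_exp`, `exp_geodGen_conj`,
the isometry `geodRot`; row 7's `SphereFrameLift.lean` / `SphereDriftLift.lean` / `SphereHMCExact.lean`:
`ambientKick`, `ambientDrift`, `ambientFlip`, `leapfrogPerm F δ = K(δ/2) D(δ) K(δ/2)`) and Mathlib
(`LinearIsometry.toLinearIsometryEquiv`, `Function.Semiconj`); nothing is cited as a fact; no number.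

THE POINT (fourth brick of the body-frame reduction; design in HOME/eng-latcore/HANDOFF.md GEN-19).
Describe a phase point `(x, p)` of the one-sphere HMC (`x ∈ S^{m−1} ⊂ ℝ^m`, ambient momentum `p`) by an
ORTHONORMAL FRAME `W` (a linear isometry equivalence of `ℝ^m`) and a BODY MOMENTUM `q` through a fixed
pole `e`: `x = W e`, `p = W q` (`isoFrame e (W, q)`).  Then
* the kick `p ← p + δF(x)` is `q ← q + δ·W⁻¹F(W e)` (`bfKick`; `isoFrame_bfKick`),
* the exact geodesic drift is `W ← W ∘ e^{tA(e,q)}`, `q` UNCHANGED (`bfDrift`; `isoFrame_bfDrift`, from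
  `ambientDrift_frame`),
* the flip is `q ← −q` (`bfFlip`; `isoFrame_bfFlip`),
so every word in these letters — in particular row 7's leapfrog step `leapfrogPerm F δ` and its `n`-th
power, the engine's trajectory — is INTERTWINED by `isoFrame e` with the same word in the body frame
(**`isoFrame_bfLeapfrog`**, **`isoFrame_bfLeapfrog_iterate`**): along a trajectory the frame is a PRODUCT
of geodesic rotations `W_n = W_0 ∘ e^{δA(e,q_0⁺)} ∘ ⋯ ∘ e^{δA(e,q_{n−1}⁺)}` whose generators `A(e, q) = q⊗e − e⊗q`
are LINEAR in the body momentum — the structure of the kicked-product systems of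
`KickedProductTrajectory.lean` (there: `SU(N)`, left multiplication; here: read `V = W⁻¹`).

NOT CLAIMED: the analytic half (the `η`-defects of `exp` / of the chart on the operator algebra, the
two-point estimate, the local cap minorisation, the position law, ergodicity at `nstep ≥ 2`) — the
successor's items; families of spheres / the `cpn_2d` link factors (componentwise bookkeeping as in
`SphereFamilyLeapfrog.lean`); matrices; anything quantitative.
-/

noncomputable section

namespace Summit.Ventures.LatticeQCDFlow.Exactness

open Real NormedSpace Metric Function
open scoped InnerProductSpace

variable {m : Type*} [Fintype m]

/-! ## §1 Frames and the frame map -/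

/-- The geodesic rotation `e^{τA(x,p)}` as a linear isometry EQUIVALENCE of `ℝ^m` (finite dimension). -/
def geodRotEquiv (x p : EuclideanSpace ℝ m) (t : ℝ) : EuclideanSpace ℝ m ≃ₗᵢ[ℝ] EuclideanSpace ℝ m :=
  (geodRot x p t).toLinearIsometryEquiv rfl

/-- Pointwise: `geodRotEquiv x p τ y = e^{τA(x,p)} y`. -/
@[simp] theorem geodRotEquiv_apply (x p y : EuclideanSpace ℝ m) (t : ℝ) :
    geodRotEquiv x p t y = exp (t • geodGen x p) y := by
  rw [geodRotEquiv, LinearIsometry.toLinearIsometryEquiv_apply, geodRot_apply]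

/-- **The frame map** through the pole `e`: `(W, q) ↦ (W e, W q)` (position on the sphere, ambient momentum). -/
def isoFrame (e : sphere (0 : EuclideanSpace ℝ m) 1)
    (w : (EuclideanSpace ℝ m ≃ₗᵢ[ℝ] EuclideanSpace ℝ m) × EuclideanSpace ℝ m) :
    (sphere (0 : EuclideanSpace ℝ m) 1) × EuclideanSpace ℝ m :=
  (⟨w.1 (e : EuclideanSpace ℝ m), by
      rw [mem_sphere_zero_iff_norm, LinearIsometryEquiv.norm_map, norm_eq_of_mem_sphere e]⟩, w.1 w.2)

/-- Components of the frame map. -/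
@[simp] theorem isoFrame_fst_coe (e : sphere (0 : EuclideanSpace ℝ m) 1)
    (w : (EuclideanSpace ℝ m ≃ₗᵢ[ℝ] EuclideanSpace ℝ m) × EuclideanSpace ℝ m) :
    ((isoFrame e w).1 : EuclideanSpace ℝ m) = w.1 (e : EuclideanSpace ℝ m) := rfl

/-- Components of the frame map. -/
@[simp] theorem isoFrame_snd (e : sphere (0 : EuclideanSpace ℝ m) 1)
    (w : (EuclideanSpace ℝ m ≃ₗᵢ[ℝ] EuclideanSpace ℝ m) × EuclideanSpace ℝ m) :
    (isoFrame e w).2 = w.1 w.2 := rfl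

/-- Every phase point has a frame (the frame map is onto): given `(x, p)` pick any isometry `W` with
`W e = x` — here recorded in the weaker form actually used downstream: the point `(W e, W q)` itself. -/
theorem isoFrame_surjective_of (e : sphere (0 : EuclideanSpace ℝ m) 1)
    (W : EuclideanSpace ℝ m ≃ₗᵢ[ℝ] EuclideanSpace ℝ m) (z : (sphere (0 : EuclideanSpace ℝ m) 1) × EuclideanSpace ℝ m)
    (hz : (z.1 : EuclideanSpace ℝ m) = W (e : EuclideanSpace ℝ m)) :
    isoFrame e (W, W.symm z.2) = z := by
  refine Prod.ext (Subtype.ext ?_) ?_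
  · simp [hz]
  · simp

/-! ## §2 The letters in the body frame -/

/-- **Body-frame kick**: `q ← q + δ·W⁻¹ F(W e)`. -/
def bfKick (F : EuclideanSpace ℝ m → EuclideanSpace ℝ m) (δ : ℝ) (e : sphere (0 : EuclideanSpace ℝ m) 1)
    (w : (EuclideanSpace ℝ m ≃ₗᵢ[ℝ] EuclideanSpace ℝ m) × EuclideanSpace ℝ m) :
    (EuclideanSpace ℝ m ≃ₗᵢ[ℝ] EuclideanSpace ℝ m) × EuclideanSpace ℝ m :=
  (w.1, w.2 + δ • w.1.symm (F (w.1 (e : EuclideanSpace ℝ m))))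

/-- **Body-frame drift**: `W ← W ∘ e^{tA(e,q)}`, `q` unchanged. -/
def bfDrift (t : ℝ) (e : sphere (0 : EuclideanSpace ℝ m) 1)
    (w : (EuclideanSpace ℝ m ≃ₗᵢ[ℝ] EuclideanSpace ℝ m) × EuclideanSpace ℝ m) :
    (EuclideanSpace ℝ m ≃ₗᵢ[ℝ] EuclideanSpace ℝ m) × EuclideanSpace ℝ m :=
  ((geodRotEquiv (e : EuclideanSpace ℝ m) w.2 t).trans w.1, w.2)

/-- **Body-frame flip**: `q ← −q`. -/
def bfFlip (w : (EuclideanSpace ℝ m ≃ₗᵢ[ℝ] EuclideanSpace ℝ m) × EuclideanSpace ℝ m) :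
    (EuclideanSpace ℝ m ≃ₗᵢ[ℝ] EuclideanSpace ℝ m) × EuclideanSpace ℝ m :=
  (w.1, -w.2)

variable (e : sphere (0 : EuclideanSpace ℝ m) 1)

/-- The kick is intertwined: `isoFrame (bfKick (W, q)) = ambientKick (isoFrame (W, q))`. -/
theorem isoFrame_bfKick (F : EuclideanSpace ℝ m → EuclideanSpace ℝ m) (δ : ℝ) :
    Semiconj (isoFrame e) (bfKick F δ e) (ambientKick F δ) := by
  intro w
  refine Prod.ext (Subtype.ext rfl) ?_
  simp [isoFrame, bfKick, ambientKick, map_add, map_smul]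

/-- The drift is intertwined: `isoFrame (bfDrift t (W, q)) = ambientDrift t (isoFrame (W, q))` — the
conjugation rule `e^{tA(We,Wq)} W = W e^{tA(e,q)}`. -/
theorem isoFrame_bfDrift (t : ℝ) : Semiconj (isoFrame e) (bfDrift t e) (ambientDrift t) := by
  intro w
  obtain ⟨h1, h2⟩ := ambientDrift_frame t w.1 e w.2 (isoFrame e w).1 rfl
  refine Prod.ext (Subtype.ext ?_) ?_
  · rw [show ((isoFrame e w).1, w.1 w.2) = isoFrame e w from rfl] at h1
    rw [h1]
    simp [isoFrame, bfDrift]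
  · rw [show ((isoFrame e w).1, w.1 w.2) = isoFrame e w from rfl] at h2
    rw [h2]
    simp [isoFrame, bfDrift]

/-- The flip is intertwined. -/
theorem isoFrame_bfFlip : Semiconj (isoFrame e) (bfFlip (m := m)) ambientFlip := by
  intro w
  refine Prod.ext (Subtype.ext rfl) ?_
  simp [isoFrame, bfFlip, ambientFlip]

/-! ## §3 Words: the leapfrog step and the trajectory -/

/-- **The body-frame leapfrog step** `K(δ/2) D(δ) K(δ/2)`. -/
def bfLeapfrog (F : EuclideanSpace ℝ m → EuclideanSpace ℝ m) (δ : ℝ)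
    (w : (EuclideanSpace ℝ m ≃ₗᵢ[ℝ] EuclideanSpace ℝ m) × EuclideanSpace ℝ m) :
    (EuclideanSpace ℝ m ≃ₗᵢ[ℝ] EuclideanSpace ℝ m) × EuclideanSpace ℝ m :=
  bfKick F (δ / 2) e (bfDrift δ e (bfKick F (δ / 2) e w))

/-- **Row 7's sphere leapfrog step is intertwined with the body-frame step.** -/
theorem isoFrame_bfLeapfrog (F : EuclideanSpace ℝ m → EuclideanSpace ℝ m) (δ : ℝ) :
    Semiconj (isoFrame e) (bfLeapfrog e F δ) (leapfrogPerm F δ) := by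
  intro w
  change isoFrame e (bfKick F (δ / 2) e (bfDrift δ e (bfKick F (δ / 2) e w))) =
    ambientKick F (δ / 2) (ambientDrift δ (ambientKick F (δ / 2) (isoFrame e w)))
  rw [isoFrame_bfKick, isoFrame_bfDrift, isoFrame_bfKick]

/-- **THE TRAJECTORY IN THE BODY FRAME**: `n` leapfrog steps from `(W e, W q)` are `isoFrame` of `n`
body-frame steps from `(W, q)` — the frame after the trajectory is `W` composed with the product of the
geodesic rotations met along the way, the body momentum is `q` plus the body-frame kicks. -/
theorem isoFrame_bfLeapfrog_iterate (F : EuclideanSpace ℝ m → EuclideanSpace ℝ m) (δ : ℝ) (n : ℕ)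
    (w : (EuclideanSpace ℝ m ≃ₗᵢ[ℝ] EuclideanSpace ℝ m) × EuclideanSpace ℝ m) :
    isoFrame e ((bfLeapfrog e F δ)^[n] w) = (leapfrogPerm F δ ^ n) (isoFrame e w) := by
  rw [Equiv.Perm.coe_pow]
  exact (isoFrame_bfLeapfrog e F δ).iterate_right n w

/-- … and the proposal "trajectory then flip" likewise. -/
theorem isoFrame_bfFlip_bfLeapfrog_iterate (F : EuclideanSpace ℝ m → EuclideanSpace ℝ m) (δ : ℝ) (n : ℕ)
    (w : (EuclideanSpace ℝ m ≃ₗᵢ[ℝ] EuclideanSpace ℝ m) × EuclideanSpace ℝ m) :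
    isoFrame e (bfFlip ((bfLeapfrog e F δ)^[n] w)) = ambientFlip ((leapfrogPerm F δ ^ n) (isoFrame e w)) := by
  rw [isoFrame_bfFlip, isoFrame_bfLeapfrog_iterate]

end Summit.Ventures.LatticeQCDFlow.Exactness
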